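import Summits.NavierStokesRegularity.TurbBounds.Results.S1000Modes
import Summits.NavierStokesRegularity.TurbBounds.Certs.S1000.ModeForm9
import Summits.NavierStokesRegularity.TurbBounds.Certs.S1000.ModeForm10
import Summits.NavierStokesRegularity.TurbBounds.Certs.S1000.ModeForm11
import Summits.NavierStokesRegularity.TurbBounds.Certs.S1000.ModeForm12
import Summits.NavierStokesRegularity.TurbBounds.Certs.S1000.ModeForm13
import Summits.NavierStokesRegularity.TurbBounds.Certs.S1000.ModeForm14
import HarnessLib

/-!
# Row R1 = C1′ (FW16 shear layer, Γx = 2, Gr = 10³): the polynomial positivity of the fourteen certified modes DISCHARGED —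
# the headline shear row from the cited reduction ALONE
(cell `pub-turb` / `turb-bounds`, shear lane; v2, written by pub-turb-shear gen 7, 2026-08-22 (generator lean-t12/frame/twins/gen_s1000.py). Lands after
`Results/S1000`, `ShearPolyBridge` and the Cb items `Certs/S1000/ModeForm1…14` (gen 6; each over six `SpecPieces<m>c<k>` chunk files).)

HONEST FRAMING: rigorous bounds for the stated PDE and boundary conditions; no claim about physical turbulence beyond the bound.
`polyPositivity_holds : Results.S1000.PolyPositivityS1000` (modes 9–14 here, `N_m = 24,22,26,24,28,28`; modes 1–8 in `Results/S1000Modes.lean`).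
CONSEQUENCE: `ceps_bound_of_reduction (ū) (hRed : FW16Reduction 2 1000 ū) : 1000/ū² ≤ Scalars.Ceps ≤ 0.00747522017` (CERTIFIED.md row R1, the headline shear row,
8.36× below Hagstrom–Doering's 1/16), `surfaceVelocity_bound_of_reduction : 365.753091564 ≤ U ≤ ū`, `fw16Positivity_holds` (unconditional) — ONE named hypothesis, the
cited reduction; everything else (14 LMI blocks, generator identities, tail lemma, cross-term split, cutoff m ≥ 15, relaxation, density, profile arithmetic) kernel-checked.
-/

set_option linter.style.longLine false

noncomputable section

namespace Summit.NavierStokesRegularity.TurbBounds.Results.S1000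

open Polynomial intervalIntegral MeasureTheory Set Finset Literature.Analysis.SpecialFunctions
open Summit.NavierStokesRegularity.TurbBounds.LadderTail (w w_pos IsLadder)
open Summit.NavierStokesRegularity.TurbBounds.LegendreCoeffs
open Summit.NavierStokesRegularity.TurbBounds.ShearForm
open Summit.NavierStokesRegularity.TurbBounds.ShearPolyBridge
open Summit.NavierStokesRegularity.TurbBounds.ShearSpecPieces
open Summit.NavierStokesRegularity.TurbBounds.Certs.S1000

/-! ## Certified modes 9–14 -/

/-- **Mode 9 of R1 (`N = 24`, `P = 20`) on polynomial pairs.** -/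
theorem polyPositivity_mode9 (Up Vp : ℝ[X]) (hU0 : Up.eval (-1) = 0) (hU1 : (derivative Up).eval (-1) = 0) (hU2 : Up.eval 1 = 0)
    (hV0 : Vp.eval (-1) = 0) (hV1 : (derivative Vp).eval (-1) = 0) (hV2 : Vp.eval 1 = 0) :
    0 ≤ shearForm (Acell (Scalars.Gx : ℝ) 9) (Ccell (Scalars.Gx : ℝ) 9) (Dcell (Scalars.Gx : ℝ) 9)
      (fun x => profileS1000.eval x) (fun x => Up.eval x) (fun x => Vp.eval x) := by
  set L := max Up.natDegree Vp.natDegree + 1 with hL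
  have hLU : Up.natDegree < L := by omega
  have hLV : Vp.natDegree < L := by omega
  have hphi : ∀ p, p < 20 + 1 → ModeForm.M9.phi p = phiS1000 p := by
    intro p hp; unfold ModeForm.M9.phi phiS1000; interval_cases p <;> rfl
  have hprof : profileS1000 = gpOf 20 ModeForm.M9.phi := by
    unfold profileS1000 gpOf; exact sum_congr rfl fun p hp => by rw [hphi p (mem_range.mp hp)]
  have eA : Acell (Scalars.Gx : ℝ) 9 = ((Am Scalars.Gx SpecPieces.M9.piHi 9 : ℚ) : ℝ) := by rw [Acell_cast]; rfl
  rw [eA, Ccell_cast Scalars.Gx Scalars.piLo rfl, Dcell_cast Scalars.Gx Scalars.piLo rfl, hprof,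
    shearForm_poly_decomp 24 20 _ _ _ ModeForm.M9.phi Up Vp hU0 hU1 hV0 hV1 L hLU hLV]
  obtain ⟨hA₁, h0a₁, hB₁, hw₁⟩ := wall_data Up hU0 hU1 hU2
  obtain ⟨hA₂, h0a₂, hB₂, hw₂⟩ := wall_data Vp hV0 hV1 hV2
  have hT : ∀ x ∈ Icc (-1 : ℝ) 1, |(gpOf 20 ModeForm.M9.phi).eval x| ≤ (Scalars.T : ℝ) := by
    rw [← hprof]; exact profileS1000_abs_le
  have hX := tailX_bound 24 20 ModeForm.M9.phi Up Vp hT L hLU hLV (delta_cast_pos 24)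
  exact ModeForm.M9.modeForm_nonneg hA₁ h0a₁ hB₁ hw₁ hA₂ h0a₂ hB₂ hw₂ L hX

/-- **Mode 10 of R1 (`N = 22`, `P = 20`) on polynomial pairs.** -/
theorem polyPositivity_mode10 (Up Vp : ℝ[X]) (hU0 : Up.eval (-1) = 0) (hU1 : (derivative Up).eval (-1) = 0) (hU2 : Up.eval 1 = 0)
    (hV0 : Vp.eval (-1) = 0) (hV1 : (derivative Vp).eval (-1) = 0) (hV2 : Vp.eval 1 = 0) :
    0 ≤ shearForm (Acell (Scalars.Gx : ℝ) 10) (Ccell (Scalars.Gx : ℝ) 10) (Dcell (Scalars.Gx : ℝ) 10)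
      (fun x => profileS1000.eval x) (fun x => Up.eval x) (fun x => Vp.eval x) := by
  set L := max Up.natDegree Vp.natDegree + 1 with hL
  have hLU : Up.natDegree < L := by omega
  have hLV : Vp.natDegree < L := by omega
  have hphi : ∀ p, p < 20 + 1 → ModeForm.M10.phi p = phiS1000 p := by
    intro p hp; unfold ModeForm.M10.phi phiS1000; interval_cases p <;> rfl
  have hprof : profileS1000 = gpOf 20 ModeForm.M10.phi := by
    unfold profileS1000 gpOf; exact sum_congr rfl fun p hp => by rw [hphi p (mem_range.mp hp)]
  have eA : Acell (Scalars.Gx : ℝ) 10 = ((Am Scalars.Gx SpecPieces.M10.piHi 10 : ℚ) : ℝ) := by rw [Acell_cast]; rfl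
  rw [eA, Ccell_cast Scalars.Gx Scalars.piLo rfl, Dcell_cast Scalars.Gx Scalars.piLo rfl, hprof,
    shearForm_poly_decomp 22 20 _ _ _ ModeForm.M10.phi Up Vp hU0 hU1 hV0 hV1 L hLU hLV]
  obtain ⟨hA₁, h0a₁, hB₁, hw₁⟩ := wall_data Up hU0 hU1 hU2
  obtain ⟨hA₂, h0a₂, hB₂, hw₂⟩ := wall_data Vp hV0 hV1 hV2
  have hT : ∀ x ∈ Icc (-1 : ℝ) 1, |(gpOf 20 ModeForm.M10.phi).eval x| ≤ (Scalars.T : ℝ) := by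
    rw [← hprof]; exact profileS1000_abs_le
  have hX := tailX_bound 22 20 ModeForm.M10.phi Up Vp hT L hLU hLV (delta_cast_pos 22)
  exact ModeForm.M10.modeForm_nonneg hA₁ h0a₁ hB₁ hw₁ hA₂ h0a₂ hB₂ hw₂ L hX

/-- **Mode 11 of R1 (`N = 26`, `P = 20`) on polynomial pairs.** -/
theorem polyPositivity_mode11 (Up Vp : ℝ[X]) (hU0 : Up.eval (-1) = 0) (hU1 : (derivative Up).eval (-1) = 0) (hU2 : Up.eval 1 = 0)
    (hV0 : Vp.eval (-1) = 0) (hV1 : (derivative Vp).eval (-1) = 0) (hV2 : Vp.eval 1 = 0) :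
    0 ≤ shearForm (Acell (Scalars.Gx : ℝ) 11) (Ccell (Scalars.Gx : ℝ) 11) (Dcell (Scalars.Gx : ℝ) 11)
      (fun x => profileS1000.eval x) (fun x => Up.eval x) (fun x => Vp.eval x) := by
  set L := max Up.natDegree Vp.natDegree + 1 with hL
  have hLU : Up.natDegree < L := by omega
  have hLV : Vp.natDegree < L := by omega
  have hphi : ∀ p, p < 20 + 1 → ModeForm.M11.phi p = phiS1000 p := by
    intro p hp; unfold ModeForm.M11.phi phiS1000; interval_cases p <;> rfl
  have hprof : profileS1000 = gpOf 20 ModeForm.M11.phi := by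
    unfold profileS1000 gpOf; exact sum_congr rfl fun p hp => by rw [hphi p (mem_range.mp hp)]
  have eA : Acell (Scalars.Gx : ℝ) 11 = ((Am Scalars.Gx SpecPieces.M11.piHi 11 : ℚ) : ℝ) := by rw [Acell_cast]; rfl
  rw [eA, Ccell_cast Scalars.Gx Scalars.piLo rfl, Dcell_cast Scalars.Gx Scalars.piLo rfl, hprof,
    shearForm_poly_decomp 26 20 _ _ _ ModeForm.M11.phi Up Vp hU0 hU1 hV0 hV1 L hLU hLV]
  obtain ⟨hA₁, h0a₁, hB₁, hw₁⟩ := wall_data Up hU0 hU1 hU2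
  obtain ⟨hA₂, h0a₂, hB₂, hw₂⟩ := wall_data Vp hV0 hV1 hV2
  have hT : ∀ x ∈ Icc (-1 : ℝ) 1, |(gpOf 20 ModeForm.M11.phi).eval x| ≤ (Scalars.T : ℝ) := by
    rw [← hprof]; exact profileS1000_abs_le
  have hX := tailX_bound 26 20 ModeForm.M11.phi Up Vp hT L hLU hLV (delta_cast_pos 26)
  exact ModeForm.M11.modeForm_nonneg hA₁ h0a₁ hB₁ hw₁ hA₂ h0a₂ hB₂ hw₂ L hX

/-- **Mode 12 of R1 (`N = 24`, `P = 20`) on polynomial pairs.** -/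
theorem polyPositivity_mode12 (Up Vp : ℝ[X]) (hU0 : Up.eval (-1) = 0) (hU1 : (derivative Up).eval (-1) = 0) (hU2 : Up.eval 1 = 0)
    (hV0 : Vp.eval (-1) = 0) (hV1 : (derivative Vp).eval (-1) = 0) (hV2 : Vp.eval 1 = 0) :
    0 ≤ shearForm (Acell (Scalars.Gx : ℝ) 12) (Ccell (Scalars.Gx : ℝ) 12) (Dcell (Scalars.Gx : ℝ) 12)
      (fun x => profileS1000.eval x) (fun x => Up.eval x) (fun x => Vp.eval x) := by
  set L := max Up.natDegree Vp.natDegree + 1 with hL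
  have hLU : Up.natDegree < L := by omega
  have hLV : Vp.natDegree < L := by omega
  have hphi : ∀ p, p < 20 + 1 → ModeForm.M12.phi p = phiS1000 p := by
    intro p hp; unfold ModeForm.M12.phi phiS1000; interval_cases p <;> rfl
  have hprof : profileS1000 = gpOf 20 ModeForm.M12.phi := by
    unfold profileS1000 gpOf; exact sum_congr rfl fun p hp => by rw [hphi p (mem_range.mp hp)]
  have eA : Acell (Scalars.Gx : ℝ) 12 = ((Am Scalars.Gx SpecPieces.M12.piHi 12 : ℚ) : ℝ) := by rw [Acell_cast]; rfl
  rw [eA, Ccell_cast Scalars.Gx Scalars.piLo rfl, Dcell_cast Scalars.Gx Scalars.piLo rfl, hprof,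
    shearForm_poly_decomp 24 20 _ _ _ ModeForm.M12.phi Up Vp hU0 hU1 hV0 hV1 L hLU hLV]
  obtain ⟨hA₁, h0a₁, hB₁, hw₁⟩ := wall_data Up hU0 hU1 hU2
  obtain ⟨hA₂, h0a₂, hB₂, hw₂⟩ := wall_data Vp hV0 hV1 hV2
  have hT : ∀ x ∈ Icc (-1 : ℝ) 1, |(gpOf 20 ModeForm.M12.phi).eval x| ≤ (Scalars.T : ℝ) := by
    rw [← hprof]; exact profileS1000_abs_le
  have hX := tailX_bound 24 20 ModeForm.M12.phi Up Vp hT L hLU hLV (delta_cast_pos 24)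
  exact ModeForm.M12.modeForm_nonneg hA₁ h0a₁ hB₁ hw₁ hA₂ h0a₂ hB₂ hw₂ L hX

/-- **Mode 13 of R1 (`N = 28`, `P = 20`) on polynomial pairs.** -/
theorem polyPositivity_mode13 (Up Vp : ℝ[X]) (hU0 : Up.eval (-1) = 0) (hU1 : (derivative Up).eval (-1) = 0) (hU2 : Up.eval 1 = 0)
    (hV0 : Vp.eval (-1) = 0) (hV1 : (derivative Vp).eval (-1) = 0) (hV2 : Vp.eval 1 = 0) :
    0 ≤ shearForm (Acell (Scalars.Gx : ℝ) 13) (Ccell (Scalars.Gx : ℝ) 13) (Dcell (Scalars.Gx : ℝ) 13)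
      (fun x => profileS1000.eval x) (fun x => Up.eval x) (fun x => Vp.eval x) := by
  set L := max Up.natDegree Vp.natDegree + 1 with hL
  have hLU : Up.natDegree < L := by omega
  have hLV : Vp.natDegree < L := by omega
  have hphi : ∀ p, p < 20 + 1 → ModeForm.M13.phi p = phiS1000 p := by
    intro p hp; unfold ModeForm.M13.phi phiS1000; interval_cases p <;> rfl
  have hprof : profileS1000 = gpOf 20 ModeForm.M13.phi := by
    unfold profileS1000 gpOf; exact sum_congr rfl fun p hp => by rw [hphi p (mem_range.mp hp)]
  have eA : Acell (Scalars.Gx : ℝ) 13 = ((Am Scalars.Gx SpecPieces.M13.piHi 13 : ℚ) : ℝ) := by rw [Acell_cast]; rfl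
  rw [eA, Ccell_cast Scalars.Gx Scalars.piLo rfl, Dcell_cast Scalars.Gx Scalars.piLo rfl, hprof,
    shearForm_poly_decomp 28 20 _ _ _ ModeForm.M13.phi Up Vp hU0 hU1 hV0 hV1 L hLU hLV]
  obtain ⟨hA₁, h0a₁, hB₁, hw₁⟩ := wall_data Up hU0 hU1 hU2
  obtain ⟨hA₂, h0a₂, hB₂, hw₂⟩ := wall_data Vp hV0 hV1 hV2
  have hT : ∀ x ∈ Icc (-1 : ℝ) 1, |(gpOf 20 ModeForm.M13.phi).eval x| ≤ (Scalars.T : ℝ) := by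
    rw [← hprof]; exact profileS1000_abs_le
  have hX := tailX_bound 28 20 ModeForm.M13.phi Up Vp hT L hLU hLV (delta_cast_pos 28)
  exact ModeForm.M13.modeForm_nonneg hA₁ h0a₁ hB₁ hw₁ hA₂ h0a₂ hB₂ hw₂ L hX

/-- **Mode 14 of R1 (`N = 28`, `P = 20`) on polynomial pairs.** -/
theorem polyPositivity_mode14 (Up Vp : ℝ[X]) (hU0 : Up.eval (-1) = 0) (hU1 : (derivative Up).eval (-1) = 0) (hU2 : Up.eval 1 = 0)
    (hV0 : Vp.eval (-1) = 0) (hV1 : (derivative Vp).eval (-1) = 0) (hV2 : Vp.eval 1 = 0) :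
    0 ≤ shearForm (Acell (Scalars.Gx : ℝ) 14) (Ccell (Scalars.Gx : ℝ) 14) (Dcell (Scalars.Gx : ℝ) 14)
      (fun x => profileS1000.eval x) (fun x => Up.eval x) (fun x => Vp.eval x) := by
  set L := max Up.natDegree Vp.natDegree + 1 with hL
  have hLU : Up.natDegree < L := by omega
  have hLV : Vp.natDegree < L := by omega
  have hphi : ∀ p, p < 20 + 1 → ModeForm.M14.phi p = phiS1000 p := by
    intro p hp; unfold ModeForm.M14.phi phiS1000; interval_cases p <;> rfl
  have hprof : profileS1000 = gpOf 20 ModeForm.M14.phi := by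
    unfold profileS1000 gpOf; exact sum_congr rfl fun p hp => by rw [hphi p (mem_range.mp hp)]
  have eA : Acell (Scalars.Gx : ℝ) 14 = ((Am Scalars.Gx SpecPieces.M14.piHi 14 : ℚ) : ℝ) := by rw [Acell_cast]; rfl
  rw [eA, Ccell_cast Scalars.Gx Scalars.piLo rfl, Dcell_cast Scalars.Gx Scalars.piLo rfl, hprof,
    shearForm_poly_decomp 28 20 _ _ _ ModeForm.M14.phi Up Vp hU0 hU1 hV0 hV1 L hLU hLV]
  obtain ⟨hA₁, h0a₁, hB₁, hw₁⟩ := wall_data Up hU0 hU1 hU2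
  obtain ⟨hA₂, h0a₂, hB₂, hw₂⟩ := wall_data Vp hV0 hV1 hV2
  have hT : ∀ x ∈ Icc (-1 : ℝ) 1, |(gpOf 20 ModeForm.M14.phi).eval x| ≤ (Scalars.T : ℝ) := by
    rw [← hprof]; exact profileS1000_abs_le
  have hX := tailX_bound 28 20 ModeForm.M14.phi Up Vp hT L hLU hLV (delta_cast_pos 28)
  exact ModeForm.M14.modeForm_nonneg hA₁ h0a₁ hB₁ hw₁ hA₂ h0a₂ hB₂ hw₂ L hX

/-- **`PolyPositivityS1000`, PROVED.** -/
theorem polyPositivity_holds : PolyPositivityS1000 := by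
  intro m hm hle Up Vp hU0 hU1 hU2 hV0 hV1 hV2
  have hle' : m ≤ 14 := by simpa [Scalars.mCert] using hle
  interval_cases m
  · exact polyPositivity_mode1 Up Vp hU0 hU1 hU2 hV0 hV1 hV2
  · exact polyPositivity_mode2 Up Vp hU0 hU1 hU2 hV0 hV1 hV2
  · exact polyPositivity_mode3 Up Vp hU0 hU1 hU2 hV0 hV1 hV2
  · exact polyPositivity_mode4 Up Vp hU0 hU1 hU2 hV0 hV1 hV2
  · exact polyPositivity_mode5 Up Vp hU0 hU1 hU2 hV0 hV1 hV2
  · exact polyPositivity_mode6 Up Vp hU0 hU1 hU2 hV0 hV1 hV2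
  · exact polyPositivity_mode7 Up Vp hU0 hU1 hU2 hV0 hV1 hV2
  · exact polyPositivity_mode8 Up Vp hU0 hU1 hU2 hV0 hV1 hV2
  · exact polyPositivity_mode9 Up Vp hU0 hU1 hU2 hV0 hV1 hV2
  · exact polyPositivity_mode10 Up Vp hU0 hU1 hU2 hV0 hV1 hV2
  · exact polyPositivity_mode11 Up Vp hU0 hU1 hU2 hV0 hV1 hV2
  · exact polyPositivity_mode12 Up Vp hU0 hU1 hU2 hV0 hV1 hV2
  · exact polyPositivity_mode13 Up Vp hU0 hU1 hU2 hV0 hV1 hV2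
  · exact polyPositivity_mode14 Up Vp hU0 hU1 hU2 hV0 hV1 hV2

/-! ## Row R1 from the cited reduction alone (parameters as literals: `Γx = 2`, `Gr = 1000`) -/

/-- FW16's spectral constraint for the certified profile of R1, every mode `m ≥ 1`, the whole admissible `C²` class — UNCONDITIONAL. -/
theorem fw16Positivity_holds : FW16Positivity (2 : ℝ) (fun x => profileS1000.eval x) := by
  have hGx : ((Scalars.Gx : ℚ) : ℝ) = 2 := by norm_num [Scalars.Gx]
  rw [← hGx]; exact fw16Positivity_of_polyPositivity polyPositivity_holds

/-- **Row R1, mean surface velocity, from ONE named hypothesis**: `FW16Reduction 2 1000 ū → U ≤ ū` (`U = Scalars.U ≥ 365.753091564`). -/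
theorem surfaceVelocity_bound_of_reduction (ubar : ℝ) (hRed : FW16Reduction (2 : ℝ) 1000 ubar) : (Scalars.U : ℝ) ≤ ubar := by
  have hGx : ((Scalars.Gx : ℚ) : ℝ) = 2 := by norm_num [Scalars.Gx]
  have hGr : ((Scalars.Gr : ℚ) : ℝ) = 1000 := by norm_num [Scalars.Gr]
  rw [← hGx, ← hGr] at hRed
  exact surfaceVelocity_bound ubar hRed polyPositivity_holds

/-- **Row R1, dissipation coefficient, from ONE named hypothesis**: `FW16Reduction 2 1000 ū → 1000/ū² ≤ Scalars.Ceps`. -/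
theorem ceps_bound_of_reduction (ubar : ℝ) (hRed : FW16Reduction (2 : ℝ) 1000 ubar) : (1000 : ℝ) / ubar ^ 2 ≤ (Scalars.Ceps : ℝ) := by
  have hGx : ((Scalars.Gx : ℚ) : ℝ) = 2 := by norm_num [Scalars.Gx]
  have hGr : ((Scalars.Gr : ℚ) : ℝ) = 1000 := by norm_num [Scalars.Gr]
  rw [← hGx, ← hGr] at hRed
  rw [← hGr]
  exact ceps_bound ubar hRed polyPositivity_holds

/-- … with the outward decimal of CERTIFIED.md row R1: `C_ε ≤ 0.00747522017`. -/
theorem ceps_bound_decimal_of_reduction (ubar : ℝ) (hRed : FW16Reduction (2 : ℝ) 1000 ubar) :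
    (1000 : ℝ) / ubar ^ 2 ≤ (747522017 : ℝ) / 100000000000 := by
  have hGx : ((Scalars.Gx : ℚ) : ℝ) = 2 := by norm_num [Scalars.Gx]
  have hGr : ((Scalars.Gr : ℚ) : ℝ) = 1000 := by norm_num [Scalars.Gr]
  rw [← hGx, ← hGr] at hRed
  rw [← hGr]
  exact ceps_bound_decimal ubar hRed polyPositivity_holds

/-- Vacuity guard, now unconditional: the hypothesis is not provable for every `ū` (`ū = 0` fails). -/
theorem fw16Reduction_nontrivial_holds : ¬ FW16Reduction (2 : ℝ) 1000 0 := by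
  have hGx : ((Scalars.Gx : ℚ) : ℝ) = 2 := by norm_num [Scalars.Gx]
  have hGr : ((Scalars.Gr : ℚ) : ℝ) = 1000 := by norm_num [Scalars.Gr]
  rw [← hGx, ← hGr]
  exact fw16Reduction_nontrivial polyPositivity_holds

end Summit.NavierStokesRegularity.TurbBounds.Results.S1000

end
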